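import Literature.Probability.LatticeModels.SharpLengthDCPProofs
import HarnessLib

/-!
# Stub `stub_fluxCreationIdentity` (line `box-superset`, crux `CoerciveSharpness.PhiCoercive`, stmt-CriticalPhenomena-18196)

The "discrete Gauss / creation identity" that opens the idea card
`surface-creation-superharmonicity`: for every finite `S ⊆ ℤ³` and every `u : ℤ³ → ℝ`,
`Σ_{x ∈ S} #{y ∉ S : y ∼ x} · u(x) = Σ_{x ∈ S} (6 u(x) − Σ_{y ∼ x, y ∈ S} u(y))`.

Pure finite bookkeeping, nothing probabilistic (in the crux `u(x) = ⟨σ₀σ_x⟩^free_S`):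
* double counting over the symmetric adjacency relation of `ℤ³`
  (`sum_sum_neighbor_mem_eq`): `Σ_{x ∈ S} Σ_{y ∼ x, y ∈ S} u(y) = Σ_{y ∈ S} #{x ∈ S : x ∼ y} · u(y)`
  (Mathlib's `Finset.sum_comm'` with `SimpleGraph.Adj.symm`);
* every site of `ℤ³` has exactly `6 = #{y ∼ x : y ∈ S} + #{y ∼ x : y ∉ S}` neighbours
  (`card_neighborFinset_zdGraph_holds`, `Finset.card_filter_add_card_filter_not`).
-/

noncomputable section

namespace Summit.CriticalPhenomena.Ising3DConformalLimit.Cruxes.PhiCoercive.BoxSuperset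

open scoped BigOperators
open Finset
open Literature.Probability.LatticeModels

/-- Double counting over the symmetric adjacency relation of `ℤ³`: summing `u` over the
`S`-neighbours `y` of every `x ∈ S` counts each `y ∈ S` once per `S`-neighbour of `y`. -/
private theorem sum_sum_neighbor_mem_eq (S : Finset (Site 3)) (u : Site 3 → ℝ) :
    ∑ x ∈ S, ∑ y ∈ ((zdGraph 3).neighborFinset x).filter (fun y => y ∈ S), u y =
      ∑ y ∈ S, ((((zdGraph 3).neighborFinset y).filter fun x => x ∈ S).card : ℝ) * u y := by
  rw [Finset.sum_comm' (t' := S)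
    (s' := fun y => ((zdGraph 3).neighborFinset y).filter fun x => x ∈ S)]
  · refine Finset.sum_congr rfl fun y _ => ?_
    rw [Finset.sum_const, nsmul_eq_mul]
  · intro x y
    simp only [Finset.mem_filter, SimpleGraph.mem_neighborFinset]
    constructor
    · rintro ⟨hx, hxy, hy⟩
      exact ⟨⟨hxy.symm, hx⟩, hy⟩
    · rintro ⟨⟨hyx, hx⟩, hy⟩
      exact ⟨hx, hyx.symm, hy⟩

/-- Every site `x` of `ℤ³` has `6` neighbours, split into those inside and those outside `S`:
`#{y ∼ x : y ∉ S} = 6 − #{y ∼ x : y ∈ S}`. -/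
private theorem card_neighbor_notMem_eq (S : Finset (Site 3)) (x : Site 3) :
    ((((zdGraph 3).neighborFinset x).filter fun y => y ∉ S).card : ℝ) =
      6 - ((((zdGraph 3).neighborFinset x).filter fun y => y ∈ S).card : ℝ) := by
  have h := Finset.card_filter_add_card_filter_not (s := (zdGraph 3).neighborFinset x)
    (fun y => y ∈ S)
  rw [card_neighborFinset_zdGraph_holds x] at h
  have h' : ((((zdGraph 3).neighborFinset x).filter fun y => y ∈ S).card : ℝ) +
      ((((zdGraph 3).neighborFinset x).filter fun y => y ∉ S).card : ℝ) = 6 := by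
    exact_mod_cast h
  linarith

/-- **Stub `stub_fluxCreationIdentity` (discrete Gauss / creation identity).** For every finite
`S ⊆ ℤ³` and every `u : ℤ³ → ℝ`,
`Σ_{x ∈ S} #{y ∉ S : y ∼ x} · u(x) = Σ_{x ∈ S} (6 u(x) − Σ_{y ∼ x, y ∈ S} u(y))`:
the boundary-weighted sum of `u` over `S` equals the total "creation" `6u − (sum over
S-neighbours)`, because adjacency is symmetric and every site of `ℤ³` has exactly `6` neighbours. -/
theorem stub_fluxCreationIdentity : ∀ (S : Finset (Site 3)) (u : Site 3 → ℝ),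
    ∑ x ∈ S, ((((zdGraph 3).neighborFinset x).filter fun y => y ∉ S).card : ℝ) * u x =
      ∑ x ∈ S, (6 * u x - ∑ y ∈ ((zdGraph 3).neighborFinset x).filter (fun y => y ∈ S), u y) := by
  intro S u
  rw [Finset.sum_sub_distrib, sum_sum_neighbor_mem_eq, ← Finset.sum_sub_distrib]
  refine Finset.sum_congr rfl fun x _ => ?_
  rw [card_neighbor_notMem_eq]
  ring

end Summit.CriticalPhenomena.Ising3DConformalLimit.Cruxes.PhiCoercive.BoxSuperset

end
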